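import Summits.CriticalPhenomena.PercolationContinuityZ3.Theorems.PercNearOneGluingNoHeavyQuantGluedWindowHeavyTopI
import Summits.CriticalPhenomena.PercolationContinuityZ3.Theorems.PercNearOneGluingNoHeavyQuantGluedWindowTopCompAdv
import HarnessLib

/-!
# QUANT lane R8, T-DEC: LEMMA W's pair condition — the HEAVY-TOP cell of the two-row regime, branch II-H (h a mid, both rows light into h, the top copy `A`
# absorbs the whole bottom copy of `l`: `t₀ ≤ t₂ϖ_A`, and the middle copy is HEAVY for `A`) PROVED WITHOUT THE CONJECTURE by the structured certificate
# "row `l` into `A`, row `l+r` takes the rest of `A` and every copy of `h`" (arm-1 gen 61, architect)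

builds on p205010 (kernel theorem, internal audit signed; external expert review pending)

Support file (`--supports stmt-CriticalPhenomena-4575`), QUANT lane seat prim-quant-arm-1 (gen 61, architect); memo
`run/shared/lean/prim/quant/prim-quant-arm-1-g61/ARCH-G61.md` §1–§3.  Theorems only; standard axioms, no sorries, no definitions.

THE CELL.  Band frame and price system of `gluedPullback_windowPair_of_lemmaW`; light window pair `(l, h)` below a cheap atom `c ≥ h`; the two-row regime with
`h` a mid (`2(l+r) < T ≤ 2(l+r+k)`, `l+r+k ≤ j`, `T ≤ 2h`), the pair still LIGHT at the glued target (`T − 2l ≤ y(h−l)`), the bottom copy of `l` compatible with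
(hence heavy for) the top copy `A = l+r+k` (`T < 2l+r+k`), BRANCH II (`(1−q)(T−2l) ≤ qg(2l+r+k−T)`, i.e. `t₀ ≤ t₂ϖ_A`: the capacity `(1−γ)t₂` of `A` at the
exact heavy power `ϖ_A = (2l+r+k−T)/(T−2l)` covers row `l`), and the middle copy HEAVY and compatible for `A` (`yk ≤ T − 2(l+r) < k`; exact heavy power
`ϖ_B = (2l+2r+k−T)/(T−2l−2r)`).  STRUCTURED CERTIFICATE (memo §1): row `l` ↦ the fraction `θ = t₀/(t₂ϖ_A)` of `A` and nothing else; row `l+r` ↦ the rest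
`1−θ` of `A` and ALL of every copy of `h` (exact light power `ϖ_b` of `(l+r, h)`; `h+r` and the discounted pool absorb at least as well).  The one inequality
left, `(1−γ)(t₁ − (t₂ − t₀/ϖ_A)ϖ_B) ≤ γϖ_b`, needs NO certificate of its own (memo §2): in q-form (`q = (1−y)/ϖ` for the light powers into `h`) it is
`(1−y) + (t₁ − X)q₁ ≤ 1/Z*`, `X = (t₂ϖ_A − t₀)ϖ_B/ϖ_A`, and follows from `lightInc_star` (★7′: `(1−y) + t₀q_c + t₁q₁ ≤ 1/(c+t₁ε+t₂ν)`), `topTransfer`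
(`1/(c+t₁ε+t₂ν) − 1/(c+t₁ε+t₂κ) ≤ t₂ϖ_A q_c`) and the COMPARATIVE ADVANTAGE `compAdv_heavy` (`ϖ_A q_c ≤ ϖ_B q₁`: `X q₁ ≥ (t₂ϖ_A − t₀)q_c`).
**`gluedPullback_windowPair_twoRow_heavyTopIIH`** (branch I: `…HeavyTopI`; middle copy light: `…HeavyTopL`).

HONEST STATUS.  `GluedLemmaW` (flow form), `GluedDominatedMass`, the band, `SiblingStep`, `FarTreeRow` OPEN; RATE class (log\*) / honest sentence of
`run/shared/lean/prim/quant/README.md` unchanged.  [this work].  Nothing here is cited as a published result.  The gluing rows served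
[cite: KozmaNitzan2024, Conjecture 3 (p. 15)]; product measure [cite: Grimmett1999, §1.3 p. 10].
-/

set_option maxHeartbeats 4000000

noncomputable section

namespace Summit.CriticalPhenomena.PercolationContinuityZ3.Theorems
namespace Quant
namespace LawDec

/-- **THE HEAVY-TOP CELL OF THE TWO-ROW REGIME, BRANCH II-H (h a mid)**: `T − 2l ≤ y(h − l)` (the pair is light at the glued target), `T < 2l + r + k` (the
bottom copy of `l` can use the top copy), `(1−q)(T−2l) ≤ qg·(2l+r+k−T)` (branch II: `t₀ ≤ t₂ϖ_A`), and the middle copy heavy and compatible for the top copy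
(`yk ≤ T − 2(l+r)`; compatibility follows from `T < 2l+r+k`) ⟹ `(1−γ)Ψ(l) + γΨ(h) ≤ 0` for every price system and every cheap `c ≥ h` — no `GluedLemmaW`.
[this work] -/
theorem gluedPullback_windowPair_twoRow_heavyTopIIH (x a q g S : ℝ) (B r k j l h c ls : ℕ) (α p : ℕ → ℝ)
    (hx0 : 0 < x) (hx1 : x < 1) (ha0 : 0 < a) (ha1 : a ≤ 1) (hq0 : 0 < q) (hq1 : q < 1) (hg0 : 0 ≤ g) (hg1 : g ≤ 1) (hr : 1 ≤ r) (hk : 1 ≤ k)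
    (hxqg : x ≤ q * g)
    (hlh : l < h) (hhB : h ≤ B) (hhj : h ≤ j) (hwin : j < h + r + k) (hlow : 2 * (l : ℝ) < a * S) (hcomp : a * S < (l : ℝ) + h)
    (hlight : pairGate (a * x) (a * S) l h < a * x)
    (hL2j : l + r + k ≤ j) (hL2mid : a * (S + q * ((r : ℝ) + k * g)) ≤ 2 * ((l : ℝ) + r + k))
    (hL1low : 2 * ((l : ℝ) + r) < a * (S + q * ((r : ℝ) + k * g))) (hhmid : a * (S + q * ((r : ℝ) + k * g)) ≤ 2 * (h : ℝ))
    (hAcomp : a * (S + q * ((r : ℝ) + k * g)) < 2 * (l : ℝ) + r + k)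
    (hbrII : (1 - q) * (a * (S + q * ((r : ℝ) + k * g)) - 2 * (l : ℝ)) ≤ q * g * (2 * (l : ℝ) + r + k - a * (S + q * ((r : ℝ) + k * g))))
    (hBheavy : (a * x) * (k : ℝ) ≤ a * (S + q * ((r : ℝ) + k * g)) - 2 * ((l : ℝ) + r))
    (hlightT : a * (S + q * ((r : ℝ) + k * g)) - 2 * (l : ℝ) ≤ (a * x) * ((h : ℝ) - l))
    (hhc : h ≤ c) (hcB : c ≤ B) (hcj : c ≤ j)
    (hp : ∀ h, 0 ≤ p h)
    (hαp : ∀ l' h', l' ≤ j → 2 * (l' : ℝ) < a * (S + q * ((r : ℝ) + k * g)) → h' ≤ B + (r + k) →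
      (j + 1 ≤ h' ∨ a * (S + q * ((r : ℝ) + k * g)) < (l' : ℝ) + h') →
      α l' ≤ usage (a * x) (a * (S + q * ((r : ℝ) + k * g))) j l' h' * p h')
    (hcheap : -(gluedPullback (a * (S + q * ((r : ℝ) + k * g))) q g j r k α p c) * (a * x)
      < (1 - a * x) * gluedPullback (a * (S + q * ((r : ℝ) + k * g))) q g j r k α p ls) :
    (1 - pairGate (a * x) (a * S) l h) * gluedPullback (a * (S + q * ((r : ℝ) + k * g))) q g j r k α p l
      + pairGate (a * x) (a * S) l h * gluedPullback (a * (S + q * ((r : ℝ) + k * g))) q g j r k α p h ≤ 0 := by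
  -- names (no `set`: the reduction theorem is applied to the original expressions at the end)
  obtain ⟨y, hy⟩ : ∃ y : ℝ, y = a * x := ⟨_, rfl⟩
  obtain ⟨T, hT⟩ : ∃ T : ℝ, T = a * (S + q * ((r : ℝ) + k * g)) := ⟨_, rfl⟩
  obtain ⟨T₀, hT₀⟩ : ∃ T₀ : ℝ, T₀ = a * S := ⟨_, rfl⟩
  have hy0 : 0 < y := by rw [hy]; exact mul_pos ha0 hx0
  have hyx : y ≤ x := by rw [hy]; nlinarith
  have hy1 : y < 1 := by linarith
  have h1y : 0 < 1 - y := by linarith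
  obtain ⟨t1, ht1⟩ : ∃ t1 : ℝ, t1 = q * (1 - g) := ⟨_, rfl⟩
  obtain ⟨t2, ht2⟩ : ∃ t2 : ℝ, t2 = q * g := ⟨_, rfl⟩
  have ht1p : 0 ≤ t1 := by rw [ht1]; exact mul_nonneg hq0.le (by linarith)
  have ht2p : 0 ≤ t2 := by rw [ht2]; exact mul_nonneg hq0.le hg0
  have ht0p : 0 ≤ 1 - t1 - t2 := by
    rw [ht1, ht2, show 1 - q * (1 - g) - q * g = 1 - q by ring]; linarith
  have hyt2 : y ≤ t2 := by rw [ht2]; linarith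
  have hr1 : (1:ℝ) ≤ r := by exact_mod_cast hr
  have hk0 : (0:ℝ) ≤ k := Nat.cast_nonneg k
  have hr0 : (0:ℝ) ≤ r := by linarith
  have hlh' : (l : ℝ) < h := by exact_mod_cast hlh
  -- geometry: d = h − l, N = T − 2l, A = T − T₀ ≤ m = t1 r + t2 (r+k)
  obtain ⟨d, hd⟩ : ∃ d : ℝ, d = (h : ℝ) - l := ⟨_, rfl⟩
  have hd0 : 0 < d := by rw [hd]; linarith
  obtain ⟨N, hN⟩ : ∃ N : ℝ, N = T - 2 * (l : ℝ) := ⟨_, rfl⟩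
  have hA : T - T₀ = a * (q * ((r : ℝ) + k * g)) := by rw [hT, hT₀]; ring
  have em : q * (1 - g) * (r : ℝ) + q * g * ((r : ℝ) + k) = q * ((r : ℝ) + k * g) := by ring
  have hAm : T - T₀ ≤ t1 * r + t2 * ((r : ℝ) + k) := by
    rw [hA, ht1, ht2]
    have h1 : a * (q * ((r : ℝ) + k * g)) ≤ 1 * (q * ((r : ℝ) + k * g)) :=
      mul_le_mul_of_nonneg_right ha1 (by positivity)
    linarith [h1, em]
  have hA0 : 0 ≤ T - T₀ := by rw [hA]; positivity
  have hN0 : 0 < N := by rw [hN, hT]; linarith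
  have hNK : N < (r : ℝ) + k := by rw [hN, hT]; linarith              -- row l compatible with A
  have hNy : N ≤ y * d := by rw [hN, hd, hT, hy]; exact hlightT      -- light at T
  have hNd : N < d := lt_of_le_of_lt hNy ((mul_lt_iff_lt_one_left hd0).mpr hy1)
  have h2rN : 2 * (r : ℝ) < N := by rw [hN, hT]; linarith
  -- y (r+k) ≤ a m ≤ N: the bottom copy is HEAVY for the top copy (automatic in the band)
  have hxq : x ≤ q := le_trans hxqg (by nlinarith)
  have hxK : x * ((r : ℝ) + k) ≤ q * ((r : ℝ) + k * g) := by
    have e1 : x * (r : ℝ) ≤ q * r := mul_le_mul_of_nonneg_right hxq hr0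
    have e2 : x * (k : ℝ) ≤ q * g * k := mul_le_mul_of_nonneg_right hxqg hk0
    linarith [e1, e2]
  have hyK : y * ((r : ℝ) + k) ≤ N := by
    have e1 : y * ((r : ℝ) + k) ≤ T - T₀ := by
      rw [hy, hA, mul_assoc]; exact mul_le_mul_of_nonneg_left hxK ha0.le
    rw [hN]; rw [hT₀] at e1; linarith
  -- the light gate of the first factor
  obtain ⟨ρ₀, hρ₀⟩ : ∃ ρ₀ : ℝ, ρ₀ = (T₀ - 2 * (l : ℝ)) / ((h : ℝ) - l) := ⟨_, rfl⟩
  have hρ₀y : ρ₀ < y := by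
    have : (T₀ - 2 * (l : ℝ)) / ((h : ℝ) - l) ≤ pairGate y T₀ l h := le_max_left _ _
    rw [hρ₀]; rw [hy, hT₀] at this ⊢; linarith
  obtain ⟨γ, hγ⟩ : ∃ γ : ℝ, γ = y ^ 2 + (1 - y) * ρ₀ := ⟨_, rfl⟩
  have hγ' : pairGate (a * x) (a * S) l h = γ := by
    rw [hγ, hρ₀, hT₀, hy]; exact pairGate_eq_light (a * x) (a * S) l h (mul_pos ha0 hx0).le (by rw [← hy, ← hT₀, ← hρ₀]; exact hρ₀y.le)
  have eρ₀ : ρ₀ = (N - (T - T₀)) / d := by rw [hρ₀, hN, hd]; congr 1; ring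
  have hρ₀0 : 0 < ρ₀ := by rw [hρ₀]; exact div_pos (by rw [hT₀]; linarith) (by linarith)
  -- credit ratios of the two rows into h at T
  obtain ⟨ρa, hρa⟩ : ∃ ρa : ℝ, ρa = N / d := ⟨_, rfl⟩
  obtain ⟨ρb, hρb⟩ : ∃ ρb : ℝ, ρb = (N - 2 * (r : ℝ)) / (d - r) := ⟨_, rfl⟩
  have hdr : 0 < d - r := by linarith
  have hρay : ρa ≤ y := by rw [hρa, div_le_iff₀ hd0]; linarith
  have hρa0 : 0 < ρa := by rw [hρa]; exact div_pos (by linarith) hd0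
  have hρb0 : 0 < ρb := by rw [hρb]; exact div_pos (by linarith) hdr
  have hN2d : N ≤ 2 * d := by rw [hN, hd, hT]; linarith
  have hρba : ρb ≤ ρa := by
    rw [hρa, hρb, div_le_div_iff₀ hdr hd0]; linarith [mul_le_mul_of_nonneg_left hN2d hr0]
  have hρby : ρb ≤ y := le_trans hρba hρay
  -- exact light powers into h
  obtain ⟨Ga, hGa⟩ : ∃ Ga : ℝ, Ga = y ^ 2 + (1 - y) * ρa := ⟨_, rfl⟩
  obtain ⟨Gb, hGb⟩ : ∃ Gb : ℝ, Gb = y ^ 2 + (1 - y) * ρb := ⟨_, rfl⟩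
  have hGa0 : 0 < Ga := by rw [hGa]; exact add_pos_of_pos_of_nonneg (pow_pos hy0 2) (mul_nonneg h1y.le hρa0.le)
  have hGb0 : 0 < Gb := by rw [hGb]; exact add_pos_of_pos_of_nonneg (pow_pos hy0 2) (mul_nonneg h1y.le hρb0.le)
  have hGa1 : 0 < 1 - Ga := by
    rw [hGa, show 1 - (y ^ 2 + (1 - y) * ρa) = (1 - y) * (1 + y - ρa) by ring]; exact mul_pos h1y (by linarith)
  have hGb1 : 0 < 1 - Gb := by
    rw [hGb, show 1 - (y ^ 2 + (1 - y) * ρb) = (1 - y) * (1 + y - ρb) by ring]; exact mul_pos h1y (by linarith)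
  obtain ⟨ϖa, hϖa⟩ : ∃ ϖa : ℝ, ϖa = (1 - Ga) / Ga := ⟨_, rfl⟩
  obtain ⟨ϖb, hϖb⟩ : ∃ ϖb : ℝ, ϖb = (1 - Gb) / Gb := ⟨_, rfl⟩
  have hϖa0 : 0 < ϖa := by rw [hϖa]; exact div_pos hGa1 hGa0
  have hϖb0 : 0 < ϖb := by rw [hϖb]; exact div_pos hGb1 hGb0
  -- validity into h (exact light rate), into h + r (nearer-to-farther), and compatibility
  have hcompa : T < (l : ℝ) + h := by rw [hN, hd] at hNd; linarith
  have hcompb : T < ((l : ℝ) + r) + h := by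
    have : N - (r : ℝ) < d := by linarith
    rw [hN, hd] at this; linarith
  have eLr : ((l + r : ℕ) : ℝ) = (l : ℝ) + r := by push_cast; ring
  have eL2 : ((l + r + k : ℕ) : ℝ) = (l : ℝ) + r + k := by push_cast; ring
  have vaH : ϖa * usage y T j l h ≤ 1 := by
    have hρ : (T - 2 * (l : ℝ)) / ((h : ℝ) - l) ≤ y := by rw [← hN, ← hd, ← hρa]; exact hρay
    rw [usage_light_eq y T j l h hy0.le hhj hρ, ← hN, ← hd, ← hρa, ← hGa, hϖa, div_mul_div_comm, mul_comm (1 - Ga) Ga,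
      div_self (mul_ne_zero hGa0.ne' hGa1.ne')]
  have vbH : ϖb * usage y T j (l + r) h ≤ 1 := by
    have e1 : (T - 2 * ((l + r : ℕ) : ℝ)) / ((h : ℝ) - ((l + r : ℕ) : ℝ)) = ρb := by rw [hρb, hN, hd, eLr]; ring_nf
    have hρ : (T - 2 * ((l + r : ℕ) : ℝ)) / ((h : ℝ) - ((l + r : ℕ) : ℝ)) ≤ y := by rw [e1]; exact hρby
    rw [usage_light_eq y T j (l + r) h hy0.le hhj hρ, e1, ← hGb, hϖb, div_mul_div_comm, mul_comm (1 - Gb) Gb,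
      div_self (mul_ne_zero hGb0.ne' hGb1.ne')]
  have hlowl : 2 * (l : ℝ) < T := by linarith
  have hlowlr : 2 * ((l + r : ℕ) : ℝ) < T := by rw [eLr]; linarith
  have vaG : ϖa * usage y T j l (h + r) ≤ 1 ∨ j < h + r := by
    by_cases hjr : h + r ≤ j
    · exact Or.inl (le_trans (mul_le_mul_of_nonneg_left (usage_anti_mid y T j l h (h + r) hy0 hy1 (by omega) hjr hlowl hcompa) hϖa0.le) vaH)
    · exact Or.inr (by omega)
  have vbG : ϖb * usage y T j (l + r) (h + r) ≤ 1 ∨ j < h + r := by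
    by_cases hjr : h + r ≤ j
    · refine Or.inl (le_trans (mul_le_mul_of_nonneg_left (usage_anti_mid y T j (l + r) h (h + r) hy0 hy1 (by omega) hjr hlowlr ?_) hϖb0.le) vbH)
      rw [eLr]; exact hcompb
    · exact Or.inr (by omega)
  -- the top copy A = l + r + k: exact heavy power for row l
  obtain ⟨ϖA, hϖA⟩ : ∃ ϖA : ℝ, ϖA = ((l : ℝ) + ((l + r + k : ℕ) : ℝ) - T) / (T - 2 * (l : ℝ)) := ⟨_, rfl⟩
  have hAcomp' : T < (l : ℝ) + ((l + r + k : ℕ) : ℝ) := by rw [eL2]; rw [hN] at hNK; linarith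
  have hAheavy : y * ((((l + r + k : ℕ) : ℝ)) - l) ≤ T - 2 * (l : ℝ) := by rw [eL2, ← hN]; linarith [hyK]
  have vA : ϖA * usage y T j l (l + r + k) ≤ 1 := by
    have e := GluedWindow.apow_heavy_valid y T 1 j l (l + r + k) hy0 hy1 hL2j hlowl hAcomp' hAheavy
    rw [← hϖA, one_mul] at e
    exact e.le
  have eϖA : ϖA = ((r : ℝ) + k - N) / N := by rw [hϖA, eL2, hN]; congr 1; ring
  have hϖA0 : 0 ≤ ϖA := by rw [eϖA]; exact div_nonneg (by linarith) hN0.le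
  have hϖApos : 0 < ϖA := by rw [eϖA]; exact div_pos (by linarith) hN0
  -- the top copy for row l + r: exact heavy power
  obtain ⟨ϖB, hϖB⟩ : ∃ ϖB : ℝ, ϖB = (((l + r : ℕ) : ℝ) + ((l + r + k : ℕ) : ℝ) - T) / (T - 2 * ((l + r : ℕ) : ℝ)) := ⟨_, rfl⟩
  have hBcomp' : T < ((l + r : ℕ) : ℝ) + ((l + r + k : ℕ) : ℝ) := by rw [eLr, eL2]; rw [hT]; linarith
  have hBheavy' : y * ((((l + r + k : ℕ) : ℝ)) - ((l + r : ℕ) : ℝ)) ≤ T - 2 * ((l + r : ℕ) : ℝ) := by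
    rw [eL2, eLr, hy, hT, show (l : ℝ) + r + k - ((l : ℝ) + r) = k by ring]; linarith [hBheavy]
  have vB : ϖB * usage y T j (l + r) (l + r + k) ≤ 1 := by
    have e := GluedWindow.apow_heavy_valid y T 1 j (l + r) (l + r + k) hy0 hy1 hL2j hlowlr hBcomp' hBheavy'
    rw [← hϖB, one_mul] at e
    exact e.le
  have eϖB : ϖB = ((r : ℝ) + k + r - N) / (N - 2 * (r : ℝ)) := by rw [hϖB, eL2, eLr, hN]; congr 1 <;> ring
  have hNr0 : 0 < N - 2 * (r : ℝ) := by linarith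
  have hϖB0 : 0 ≤ ϖB := by rw [eϖB]; exact div_nonneg (by rw [hN, hT]; linarith) hNr0.le
  -- branch II: t0 ≤ t2 ϖA, the share θ = t0/(t2 ϖA) of A for row l
  have hbr : 1 - t1 - t2 ≤ t2 * ϖA := by
    rw [eϖA, ← mul_div_assoc, le_div_iff₀ hN0, ht1, ht2, show (1 - q * (1 - g) - q * g) = 1 - q by ring]
    rw [hN, hT]; linarith [hbrII]
  have ht2ϖA : 0 < t2 * ϖA := lt_of_lt_of_le (by rw [ht1, ht2, show 1 - q * (1 - g) - q * g = 1 - q by ring]; linarith) hbr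
  obtain ⟨θ, hθ⟩ : ∃ θ : ℝ, θ = (1 - t1 - t2) / (t2 * ϖA) := ⟨_, rfl⟩
  have hθ0 : 0 ≤ θ := by rw [hθ]; exact div_nonneg ht0p ht2ϖA.le
  have hθ1 : θ ≤ 1 := by rw [hθ, div_le_one ht2ϖA]; exact hbr
  have hθc : θ * (t2 * ϖA) = 1 - t1 - t2 := by rw [hθ]; exact div_mul_cancel₀ _ ht2ϖA.ne'
  have h1θ : 0 ≤ 1 - θ := by linarith
  -- the main inequality (1−γ)(t1 − (1−θ) t2 ϖB) ≤ γ ϖb via (★II-H)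
  obtain ⟨cc, hcc⟩ : ∃ cc : ℝ, cc = 1 + y - ρa := ⟨_, rfl⟩
  obtain ⟨ee, hee⟩ : ∃ ee : ℝ, ee = (r : ℝ) / d := ⟨_, rfl⟩
  obtain ⟨kk, hkk⟩ : ∃ kk : ℝ, kk = ((r : ℝ) + k) / d := ⟨_, rfl⟩
  obtain ⟨aa, haa⟩ : ∃ aa : ℝ, aa = (T - T₀) / d := ⟨_, rfl⟩
  have enu : 1 + y - cc = ρa := by rw [hcc]; ring
  have hcc1 : 1 ≤ cc := by rw [hcc]; linarith
  have hccy : cc < 1 + y := by rw [hcc]; linarith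
  have hee0 : 0 ≤ ee := by rw [hee]; positivity
  have haa0 : 0 ≤ aa := by rw [haa]; positivity
  have hn0 : 0 < 1 + y - cc := by linarith
  have hee1 : 2 * ee < 1 + y - cc := by
    rw [hee, enu, hρa, show 2 * ((r : ℝ) / d) = (2 * r) / d by ring]; exact div_lt_div_of_pos_right (by linarith) hd0
  have hkky : y * kk ≤ 1 + y - cc := by
    rw [hkk, enu, hρa, ← mul_div_assoc]; exact div_le_div_of_nonneg_right hyK hd0.le
  have hkkn : 1 + y - cc < kk := by rw [hkk, enu, hρa]; exact div_lt_div_of_pos_right hNK hd0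
  have eϖA' : ϖA = (kk - (1 + y - cc)) / (1 + y - cc) := by
    rw [eϖA, enu, hkk, hρa, ← sub_div, div_div_div_cancel_right₀ hd0.ne']
  have eϖB' : ϖB = (kk + ee - (1 + y - cc)) / ((1 + y - cc) - 2 * ee) := by
    rw [eϖB, enu, hkk, hee, hρa, ← add_div, ← sub_div, show N / d - 2 * ((r : ℝ) / d) = (N - 2 * r) / d by ring,
      div_div_div_cancel_right₀ hd0.ne']
  have haamax : aa ≤ t1 * ee + t2 * kk := by
    rw [haa, hee, hkk, show t1 * ((r : ℝ) / d) + t2 * (((r : ℝ) + k) / d) = (t1 * r + t2 * ((r : ℝ) + k)) / d by ring]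
    exact div_le_div_of_nonneg_right hAm hd0.le
  have hden : 0 < cc + t1 * ee + t2 * kk := by
    have a1 : 0 ≤ t1 * ee := mul_nonneg ht1p hee0
    have a3 : 0 ≤ t2 * kk := mul_nonneg ht2p (by linarith)
    linarith [a1, a3]
  obtain ⟨X, hX⟩ : ∃ X : ℝ, X = (1 - θ) * t2 * ϖB := ⟨_, rfl⟩
  -- q-forms of the light powers into h, and the three ingredients: (★7′), the transfer, the comparative advantage
  obtain ⟨qc, hqcd⟩ : ∃ qc : ℝ, qc = 1 / cc - (1 - y) := ⟨_, rfl⟩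
  obtain ⟨q1, hq1d⟩ : ∃ q1 : ℝ, q1 = (1 - ee) / (cc + (1 - y) * ee) - (1 - y) := ⟨_, rfl⟩
  have L7 := lightInc_star y cc ee t1 t2 hy0 hyt2 ht1p ht0p hcc1 hccy.le hee0 hee1.le hy1
  have ea : (1 - t1 - t2) / cc = (1 - t1 - t2) * qc + (1 - t1 - t2) * (1 - y) := by rw [hqcd]; ring
  have eb : t1 * (1 - ee) / (cc + (1 - y) * ee) = t1 * q1 + t1 * (1 - y) := by rw [hq1d]; ring
  rw [ea, eb] at L7
  have tr := topTransfer y t1 t2 cc ee kk hy0 hy1 ht1p ht2p hcc1 hccy hee0 hkkn.le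
  rw [← eϖA', ← hqcd] at tr
  have CA := compAdv_heavy y cc ee kk hy0 hy1 hcc1 hccy hee0 hee1 hkkn hkky
  rw [← eϖA', ← eϖB', ← hqcd, ← hq1d] at CA
  have hX1 : t2 * ϖA * qc - (1 - t1 - t2) * qc ≤ X * q1 := by
    have h1 : (1 - θ) * t2 * (ϖA * qc) ≤ (1 - θ) * t2 * (ϖB * q1) := mul_le_mul_of_nonneg_left CA (mul_nonneg h1θ ht2p)
    have e1 : (1 - θ) * t2 * (ϖA * qc) = t2 * ϖA * qc - θ * (t2 * ϖA) * qc := by ring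
    have e2 : (1 - θ) * t2 * (ϖB * q1) = X * q1 := by rw [hX]; ring
    rw [e1, hθc, e2] at h1; exact h1
  have hDk : 1 / (cc + t1 * ee + t2 * kk) ≤ 1 / (cc + aa) := by
    rw [one_div_le_one_div hden (by linarith)]; linarith
  -- Z-form: 1/Zb = (1−ee)/(cc+(1−y)ee), Z = cc + aa; one-row instance of `lightOnly_main_of_star5` (t0 := 0)
  obtain ⟨Zb, hZb⟩ : ∃ Zb : ℝ, Zb = 1 + y - ρb := ⟨_, rfl⟩
  have hZb0 : 0 < Zb := by rw [hZb]; linarith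
  have hcce : 0 < cc + (1 - y) * ee := by have := mul_nonneg h1y.le hee0; linarith
  have eZb : 1 / Zb = (1 - ee) / (cc + (1 - y) * ee) := by
    rw [div_eq_div_iff hZb0.ne' hcce.ne', one_mul, hZb, hcc, hee, hρb, hρa]
    field_simp
    ring
  have eZ : 1 + y - ρ₀ = cc + aa := by rw [hcc, haa, eρ₀, hρa, sub_div]; ring
  have star5 : 0 / cc + (t1 - X) / Zb + (1 - (t1 - X)) * (1 - y) ≤ 1 / (1 + y - ρ₀) := by
    have e5 : (t1 - X) / Zb = (t1 - X) * q1 + (t1 - X) * (1 - y) := by rw [div_eq_mul_one_div, eZb, hq1d]; ring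
    rw [eZ, zero_div, zero_add, e5]
    linarith [L7, tr, hX1, hDk]
  have main' := lightOnly_main_of_star5 y (1 + y - ρ₀) cc Zb 0 (t1 - X) (1 - (t1 - X)) hy1 (by linarith) (by linarith) hZb0 (by ring) star5
  have eϖb : (1 - y) * Zb / (1 - (1 - y) * Zb) = ϖb := by
    rw [hϖb, hGb, hZb]; congr 1 <;> ring
  have e1γ : (1 - y) * (1 + y - ρ₀) = 1 - γ := by rw [hγ]; ring
  rw [eϖb, e1γ, show 1 - (1 - γ) = γ by ring, zero_div, zero_add] at main'
  -- main' : (1 − γ) * ((t1 − X)/ϖb) ≤ γ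
  have hγ0 : 0 < γ := by rw [hγ]; exact add_pos_of_pos_of_nonneg (pow_pos hy0 2) (mul_pos h1y hρ₀0).le
  have h1γ : 0 < 1 - γ := by
    rw [hγ, show 1 - (y ^ 2 + (1 - y) * ρ₀) = (1 - y) * (1 + y - ρ₀) by ring]; exact mul_pos h1y (by linarith)
  have cov1' : (1 - γ) * t1 ≤ (1 - θ) * ((1 - γ) * t2 * ϖB) + γ * ϖb := by
    have h2 : (1 - γ) * (t1 - X) ≤ γ * ϖb := by
      have := mul_le_mul_of_nonneg_right main' hϖb0.le
      rwa [mul_assoc, div_mul_cancel₀ _ hϖb0.ne'] at this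
    rw [hX] at h2; linarith
  have et0 : 1 - t1 - t2 = 1 - q := by rw [ht1, ht2]; ring
  -- apply the reduction theorem (shares: row l ↦ θ of A only; row l+r ↦ 1−θ of A and every copy of h)
  by_cases hjr : h + r ≤ j
  · have vbG' : ϖb * usage y T j (l + r) (h + r) ≤ 1 := by rcases vbG with h1 | h1; exacts [h1, absurd hjr (by omega)]
    refine gluedPullback_windowPair_twoRow_mid_of_assign x a q g S B r k j l h c ls α p 0 ϖA 0 0 0 ϖB ϖb ϖb ϖb
      θ 0 0 0 (1 - θ) 1 1 1
      hx0 hx1 ha0 ha1 hq0 hq1 hg0 hg1 hr hlh hhB hwin hlow hcomp hL2j hL2mid hL1low hhmid (Or.inl ⟨hjr, rfl⟩) hhc hcB hcj hp hαp hcheap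
      hϖA0 le_rfl le_rfl le_rfl hϖB0 hϖb0.le hϖb0.le hϖb0.le hθ0 le_rfl le_rfl le_rfl h1θ zero_le_one zero_le_one zero_le_one
      (by linarith) (by linarith) (by linarith) (by linarith)
      ?_ (Or.inr ?_) ?_ (Or.inl rfl) ?_ (Or.inl rfl) (Or.inl ?_)
      ?_ (Or.inr ?_) ?_ (Or.inr ?_) ?_ (Or.inr (Or.inr ?_)) (Or.inr ⟨?_, ?_⟩) ?_ ?_
    · rw [← hy, ← hT]; exact vA
    · rw [← hT, ← eL2]; exact hAcomp'
    · rw [zero_mul]; exact zero_le_one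
    · rw [zero_mul]; exact zero_le_one
    · rw [zero_mul]; exact zero_le_one
    · rw [← hy, ← hT]; exact vB
    · rw [← hT, ← eL2, ← eLr]; exact hBcomp'
    · rw [← hy, ← hT]; exact vbH
    · rw [← hT]; exact hcompb
    · rw [← hy, ← hT]; exact vbG'
    · rw [← hT]; linarith
    · rw [← hT]; exact hcompb
    · rw [← hy, ← hT]; exact vbH
    · rw [hγ', ← ht2, ← et0]
      have e : θ * ((1 - γ) * t2 * ϖA) + 0 * (γ * (1 - t1 - t2) * 0) + 0 * (γ * (q * (1 - g)) * (1 - 0) * 0) + 0 * (γ * (t2 + 0 * (q * (1 - g))) * 0)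
          = (1 - γ) * (θ * (t2 * ϖA)) := by ring
      rw [e, hθc]
    · rw [hγ', ← ht1, ← ht2, ← et0]
      have e : (1 - θ) * ((1 - γ) * t2 * ϖB) + 1 * (γ * (1 - t1 - t2) * ϖb) + 1 * (γ * t1 * (1 - 0) * ϖb) + 1 * (γ * (t2 + 0 * t1) * ϖb)
          = (1 - θ) * ((1 - γ) * t2 * ϖB) + γ * ϖb := by ring
      rw [e]; exact cov1'
  · have hjr' : j < h + r := by omega
    refine gluedPullback_windowPair_twoRow_mid_of_assign x a q g S B r k j l h c ls α p 1 ϖA 0 0 0 ϖB ϖb 0 ϖb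
      θ 0 0 0 (1 - θ) 1 1 1
      hx0 hx1 ha0 ha1 hq0 hq1 hg0 hg1 hr hlh hhB hwin hlow hcomp hL2j hL2mid hL1low hhmid (Or.inr ⟨hjr', rfl⟩) hhc hcB hcj hp hαp hcheap
      hϖA0 le_rfl le_rfl le_rfl hϖB0 hϖb0.le le_rfl hϖb0.le hθ0 le_rfl le_rfl le_rfl h1θ zero_le_one zero_le_one zero_le_one
      (by linarith) (by linarith) (by linarith) (by linarith)
      ?_ (Or.inr ?_) ?_ (Or.inl rfl) ?_ (Or.inl rfl) (Or.inl ?_)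
      ?_ (Or.inr ?_) ?_ (Or.inr ?_) ?_ (Or.inl rfl) (Or.inr ⟨?_, ?_⟩) ?_ ?_
    · rw [← hy, ← hT]; exact vA
    · rw [← hT, ← eL2]; exact hAcomp'
    · rw [zero_mul]; exact zero_le_one
    · rw [zero_mul]; exact zero_le_one
    · rw [zero_mul]; exact zero_le_one
    · rw [← hy, ← hT]; exact vB
    · rw [← hT, ← eL2, ← eLr]; exact hBcomp'
    · rw [← hy, ← hT]; exact vbH
    · rw [← hT]; exact hcompb
    · rw [zero_mul]; exact zero_le_one
    · rw [← hT]; exact hcompb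
    · rw [← hy, ← hT]; exact vbH
    · rw [hγ', ← ht2, ← et0]
      have e : θ * ((1 - γ) * t2 * ϖA) + 0 * (γ * (1 - t1 - t2) * 0) + 0 * (γ * (q * (1 - g)) * (1 - 1) * 0) + 0 * (γ * (t2 + 1 * (q * (1 - g))) * 0)
          = (1 - γ) * (θ * (t2 * ϖA)) := by ring
      rw [e, hθc]
    · rw [hγ', ← ht1, ← ht2, ← et0]
      have e : (1 - θ) * ((1 - γ) * t2 * ϖB) + 1 * (γ * (1 - t1 - t2) * ϖb) + 1 * (γ * t1 * (1 - 1) * 0) + 1 * (γ * (t2 + 1 * t1) * ϖb)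
          = (1 - θ) * ((1 - γ) * t2 * ϖB) + γ * ϖb := by ring
      rw [e]; exact cov1'

end LawDec
end Quant
end Summit.CriticalPhenomena.PercolationContinuityZ3.Theorems
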